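import Summits.BirchSwinnertonDyer.BirchSwinnertonDyer.Theorems.EdixhovenFibreFiveSevenManinSideOfCDTInt
import Summits.BirchSwinnertonDyer.BirchSwinnertonDyer.Theses.AdditiveKolyvaginRoad
import Summits.BirchSwinnertonDyer.BirchSwinnertonDyer.Theorems.AdditiveKolyvaginRoadAssembly
import Summits.BirchSwinnertonDyer.BirchSwinnertonDyer.Theorems.AdditiveKolyvaginRoadAdditiveKolyvaginKernel
import Summits.BirchSwinnertonDyer.BirchSwinnertonDyer.Theorems.AdditiveKolyvaginRoadManinFrameFromDatum
import HarnessLib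

/-!
# Route `AdditiveKolyvaginRoad`: the Manin-good frame crux (20136), its residue split (20094 / 20483 / R 20709) and the rungs
# W-ALL/2 and W-ALL/2.p>=5.r1 — MODULO THE PRINTED CALEGARI–DIMITROV–TANG **THEOREM 1 VERBATIM** (integer coefficients), not
# Remarks 58–59 — cross-route `--supports` (stmt-BirchSwinnertonDyer-20136)

Cell `pub/bsd-wall`, seat `bsd-line-edix-p1` g36 (LEAD lineage of the EdixhovenFibreFiveSeven line `kato-lever`; cross-route helper, announced on
STATUS; no seat holds these items). THEOREMS ONLY (no definition, no named fact, no instance, no `sorry`); nothing is closed by name; BSD is not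
proved; Manin's conjecture is not proved; no Manin theorem and no W-ALL class theorem is announced.

WHAT THIS FILE DOES. The Theorem-1 twin of `AdditiveKolyOfCDT.*` (ttd-p1 g31, p769664): every proof there is repeated VERBATIM with the Manin input
`AdditiveKolyOfCDT.exists_datum_not_dvd_c_of_CDT` (keyed on the Remark-58/59 reading `CalegariDimitrovTang2025_unboundedDenominators_algInt`)
replaced by `EdixhovenFibreFiveSevenOfCDTInt.exists_datum_not_dvd_c_of_CDTInt` (p811415, keyed on `CalegariDimitrovTang2025_unboundedDenominators`
= Theorem 1 of the paper AS PRINTED, via the cell bsd-f2-manin's integer chain `ManinLocalTwoThree.CDivisionInt.*`). Since the `_algInt` fact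
implies the integer one (`CalegariDimitrovTang2025_unboundedDenominators_of_algInt`), every theorem below is STRONGER than its p769664 twin.

* `maninGoodOddFrameAdditive_of_CDTInt` — **the frame crux `ManinGoodOddFrameAdditive` (20136) ⟸ Theorem 1** (modularity and Hoffstein–Luo are
  conjuncts of its own binder `PublishedInputsAdditiveKoly`); `maninFrameResidueClass_of_CDTInt` (20094), `maninFrameResidueProper_of_CDTInt`
  (20483), `maninFrameResidueProperR_of_CDTInt` (R 20709) — the same frame with the extra clauses idle.
* `wAllExclAdditive_of_koly_of_CDTInt` — **W-ALL/2 ⟸ Theorem 1 ∧ {21400, 20133, 20134, 20135} ∧ 20137**;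
  `wAllExclAdditiveFiveLeRankOne_of_koly_of_CDTInt` — **W-ALL/2.p>=5.r1 (the leaf of EdixhovenFibreFiveSeven / TeichmullerTwistDescent) ⟸
  Theorem 1 ∧ {21400, 20133, 20134} ∧ 20137**.

HONEST STATUS: CONDITIONAL on the cite-only printed fact `Literature.NumberTheory.Automorphic.CalegariDimitrovTang2025_unboundedDenominators`
(Calegari–Dimitrov–Tang, J. Amer. Math. Soc. 38 (2025), Theorem 1; statement-only in the tree) and on the OPEN Kolyvagin-side cruxes named;
the items stay OPEN by name. BSD is not proved by this; no W-ALL class theorem is proved by this; Manin's conjecture is not proved by this.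
[cite: CalegariDimitrovTang2025, Thm. 1] [cite: LingOesterle1991, Thm. 6] [cite: HoffsteinLuo1997, Thm. (nonvanishing quadratic twists)]
[cite: Knapp1993, Prop. 12.9(a)] [cite: WZhang2014, Thm. 1.1 (shape of the Kolyvagin-side cruxes)]
-/

set_option autoImplicit false
-- single-conjunct summit: `Summit.BirchSwinnertonDyer.BirchSwinnertonDyer.…` repeats the name by design
set_option linter.dupNamespace false

noncomputable section

open scoped Classical

open WeierstrassCurve Literature.NumberTheory.EllipticCurves Literature.NumberTheory.EllipticCurves.ModularForms
  Literature.NumberTheory.EllipticCurves.Rank1Residual Literature.NumberTheory.Automorphic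
  Summit.BirchSwinnertonDyer.Rank1Residual
  Summit.BirchSwinnertonDyer.BirchSwinnertonDyer.Theses.AdditiveKolyvaginRoad
  Summit.BirchSwinnertonDyer.BirchSwinnertonDyer.Theorems

namespace Summit.BirchSwinnertonDyer.BirchSwinnertonDyer.Theorems.AdditiveKolyOfCDTInt

/-! ### §1 The frame crux and its whole split, BY NAME, modulo Theorem 1 -/

/-- **The frame crux `ManinGoodOddFrameAdditive` (stmt-BirchSwinnertonDyer-20136) ⟸ CDT THEOREM 1**: at every additive `p ≥ 5` with `E[p]` irreducible
and `r_an = 1` a Manin-good odd Hoffstein–Luo frame exists — the datum with `p ∤ c` of `EdixhovenFibreFiveSevenOfCDTInt.exists_datum_not_dvd_c_of_CDTInt`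
(modularity and Hoffstein–Luo are conjuncts of the decl's own binder), then the road's `ManinFrameFromDatum.exists_oddHeegnerFrame_of_exists_not_dvd`.
Strictly stronger than `AdditiveKolyOfCDT.maninGoodOddFrameAdditive_of_CDT`. CONDITIONAL on `hCDT`; the item is not closed by this; BSD is not proved
by this. [cite: CalegariDimitrovTang2025, Thm. 1] [cite: HoffsteinLuo1997, Thm.] -/
theorem maninGoodOddFrameAdditive_of_CDTInt (hCDT : CalegariDimitrovTang2025_unboundedDenominators) :
    ManinGoodOddFrameAdditive := by
  intro hPub W _ _ p _ _ hp5 hadd hirr hr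
  have hp2 : p ≠ 2 := by omega
  exact ManinFrameFromDatum.exists_oddHeegnerFrame_of_exists_not_dvd hPub.2.2.2.2.2.1 hPub.2.2.2.2.2.2.1 W p hr hp2
    (EdixhovenFibreFiveSevenOfCDTInt.exists_datum_not_dvd_c_of_CDTInt hCDT hPub.2.2.2.2.2.1 W p hp5 hadd hirr)

/-- **`ManinFrameResidueClass` (stmt-BirchSwinnertonDyer-20094) ⟸ CDT THEOREM 1** (exception / `Iₙ*` clause idle). CONDITIONAL; the item is not closed
by this; BSD is not proved by this. [cite: CalegariDimitrovTang2025, Thm. 1] -/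
theorem maninFrameResidueClass_of_CDTInt (hCDT : CalegariDimitrovTang2025_unboundedDenominators) :
    ManinFrameResidueClass := by
  intro hPub W _ _ p _ _ hp5 hadd hirr _hcl hr
  exact maninGoodOddFrameAdditive_of_CDTInt hCDT hPub W p hp5 hadd hirr hr

/-- **`ManinFrameResidueProper` (stmt-BirchSwinnertonDyer-20483) ⟸ CDT THEOREM 1** (class clause and the «every degree divisible by `p`» clause idle).
CONDITIONAL; the item is not closed by this; BSD is not proved by this. [cite: CalegariDimitrovTang2025, Thm. 1] -/
theorem maninFrameResidueProper_of_CDTInt (hCDT : CalegariDimitrovTang2025_unboundedDenominators) :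
    ManinFrameResidueProper := by
  intro hPub W _ _ p _ _ hp5 hadd hirr _hcl _hall hr
  exact maninGoodOddFrameAdditive_of_CDTInt hCDT hPub W p hp5 hadd hirr hr

/-- **R `ManinFrameResidueProperR` (stmt-BirchSwinnertonDyer-20709, consumed by the `closes` of AdditiveKolyvaginRoad, TeichmullerTwistDescent and
EdixhovenFibreFiveSeven) ⟸ CDT THEOREM 1** (Edixhoven / Dokchitser antecedents and both residue clauses idle). CONDITIONAL; the item is not closed by
this; BSD is not proved by this. [cite: CalegariDimitrovTang2025, Thm. 1] -/
theorem maninFrameResidueProperR_of_CDTInt (hCDT : CalegariDimitrovTang2025_unboundedDenominators) :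
    ManinFrameResidueProperR := by
  intro _e1 _e2 _dd hPub W _ _ p _ _ hp5 hadd hirr _hcl _hall hr
  exact maninGoodOddFrameAdditive_of_CDTInt hCDT hPub W p hp5 hadd hirr hr

/-! ### §2 The rungs W-ALL/2 and W-ALL/2.p>=5.r1 modulo Theorem 1 and the Kolyvagin-side items -/

/-- **The rung `WAllExclAdditive` (W-ALL/2) ⟸ CDT THEOREM 1 ∧ the four Kolyvagin-side open cruxes `KolyvaginPrimitiveAdditive` (21400),
`RankZeroAdditive` (20133), `OffSharpRankOneAdditive` (20134), `AdditiveAtThree` (20135) ∧ the hypothesis-only bundle `PublishedInputsAdditiveKoly`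
(20137)** — the landed assembly (20139) with the frame of §1 and the landed kernel (20138); no Manin-side hypothesis. Strictly stronger than
`AdditiveKolyOfCDT.wAllExclAdditive_of_koly_of_CDT`. CONDITIONAL; no item is closed by this; BSD is not proved and no W-ALL class theorem is proved
by this. [cite: CalegariDimitrovTang2025, Thm. 1] [cite: WZhang2014, Thm. 1.1] -/
theorem wAllExclAdditive_of_koly_of_CDTInt (hCDT : CalegariDimitrovTang2025_unboundedDenominators)
    (h₁ : KolyvaginPrimitiveAdditive) (h₀ : RankZeroAdditive) (hoff : OffSharpRankOneAdditive) (h₃ : AdditiveAtThree)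
    (hP : PublishedInputsAdditiveKoly) :
    Summit.BirchSwinnertonDyer.WAllExclAdditive :=
  AdditiveKoly.assembly h₁ h₀ hoff h₃ (maninGoodOddFrameAdditive_of_CDTInt hCDT) hP
    AdditiveKolyvaginKernel.additiveKolyvaginKernel_proof

/-- **The rung W-ALL/2.p>=5.r1 `WAllExclAdditiveFiveLeRankOne` (the leaf of TeichmullerTwistDescent / EdixhovenFibreFiveSeven) ⟸ CDT THEOREM 1 ∧ the
three Kolyvagin-side cruxes (21400, 20133, 20134) ∧ the bundle 20137** — ♯-slice by the landed kernel fed with the frame of §1, off-♯ slice = the item,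
glued by `wAllExclAdditiveFiveLeRankOne_of_sharp_of_offSharp`. Strictly stronger than `AdditiveKolyOfCDT.wAllExclAdditiveFiveLeRankOne_of_koly_of_CDT`.
CONDITIONAL; no item is closed by this; BSD is not proved by this. [cite: CalegariDimitrovTang2025, Thm. 1] [cite: WZhang2014, Thm. 1.1] -/
theorem wAllExclAdditiveFiveLeRankOne_of_koly_of_CDTInt (hCDT : CalegariDimitrovTang2025_unboundedDenominators)
    (h₁ : KolyvaginPrimitiveAdditive) (h₀ : RankZeroAdditive) (hoff : OffSharpRankOneAdditive)
    (hP : PublishedInputsAdditiveKoly) :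
    Summit.BirchSwinnertonDyer.WAllExclAdditiveFiveLeRankOne := by
  have hSharp : Summit.BirchSwinnertonDyer.WAllExclAdditiveFiveLeRankOneSharp :=
    fun W _ _ p _ hCM hp5 hadd hr1 hs hsp htwo htam =>
      AdditiveKolyvaginKernel.additiveKolyvaginKernel_proof hP (maninGoodOddFrameAdditive_of_CDTInt hCDT) h₁ h₀
        W p hCM hp5 hadd hr1 hs hsp htwo htam
  exact Summit.BirchSwinnertonDyer.wAllExclAdditiveFiveLeRankOne_of_sharp_of_offSharp hSharp hoff

end Summit.BirchSwinnertonDyer.BirchSwinnertonDyer.Theorems.AdditiveKolyOfCDTInt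

end
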